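import Summits.QuantumFields.YangMills.Theorems.UnitScaleTiltProp7CmapTwSymInputs
import Summits.QuantumFields.YangMills.Theorems.UnitScaleTiltProp7GaugeSliceDecompositionSplit
import Summits.QuantumFields.YangMills.Theorems.UnitScaleTiltProp7SPrintDefsS
import Summits.QuantumFields.YangMills.Theorems.UnitScaleTiltProp7SymFrameGaugeResponseAt
import HarnessLib

/-!
# Route `UnitScaleTilt`, crux K1 child «MinimiserStabilityRegPr» (stmt-QuantumFields-19200), skeleton v10, stub `stub_existenceMinimalOrbit` (EX), route (α) —
# **(P2) «LANDAU TRANSVERSALITY AT THE CHART POINT», THE EXACT REDUCTION: the `hSplit`-residue after T5-B (P1) — «every direction tangent to the twisted slice at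
# `A₁ = χ(A′)` is the chart velocity of a direction of print's linear Landau slice at `U₀`, modulo a gauge direction» — follows from ONE statement (P2-core) about the
# residual gauge algebra `N_S(U₀)`, by the chain rule on the (48)-twS identity and the Hilbert half at `U₀`** (LOCATE memo `pub/ym3-torus/ym3-torus-px10/LOCATE-P2-LANDAU-px10.md`,
# 19200 evidence #58; ★w5-20520 g6 `LOCATE-TRANSPORT-ONTO-w5g6.md` §5 item 2; ★w2-19200 g4 `LOCATE-HXTW3-SPLIT-w2g4.md` §7 (LIN-2)).

Cell `ym3-torus`, width seat `ym3-torus-px10` (gen 0; WIDTH COPY of ym3-torus-p1).  THEOREMS ONLY (0 `def`, 0 `sorry`).  `--supports stmt-QuantumFields-19200 --as helper`,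
count-neutral.  YM₃ on T³ is a ladder rung (R3), not the Clay problem; nothing here claims the stub, the crux, d = 4 or the mass gap.

THE ROW.  The EX knit of record (✓`Prop7StubEXOfChartPiecesTwS6`, row `hSplit`; ✓`Prop7FibreELOfCritSplitD`, binder `hSplitD`) asks, at the chart point `U′ = e^{χ(A′)}U₀`
(`χ(A) = A − H·Dfix(CmapTwS U₀) H C₂ A`, [Balaban1985Variational] (47)), that every fibre-tangent `ξ` be `M(Dδ) + (gauge direction at U′)` with `D = Dχ(A′)`, `M` the bondwise
velocity map and `δ` in print's LINEAR slice at `U₀`: `Q(U₀)δ = 0` ((83), `QTwS`) and `R_S(U₀)D*_{U₀}δ = 0` ((45)∕(21)ˢ, `IsLandauPrintS`).  T5-B (★w5-20520 g6,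
`Prop7TwistedSliceGaugeOntoTower.exists_slice_tangent_add_gaugeDir_of_QSym_eq_zero_of_tower`) delivers `ξ = Mβ + (gauge)` with `β` tangent to the TWISTED slice,
`fderiv ℂ (logChartTwS U₀) (χ A′) β = 0`.  What is left is (P2): `β ↦ δ`.

WHAT IS PROVED (member `F`, `h : n ≤ K`; sorry-free, no definition; ns `…Theorems.Prop7LandauTransversalityReduction`):
* §1 ★`fderiv_logChartTwS_comp_chartDeriv_eq_QTwS` — STEP 1, the chain rule on (48)-twS ✓`Prop7SymAvgTwSym.logChartTwS_eq_QTwS_of_chart47twS` (an identity on the OPEN `ε`-ball):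
  `fderiv(logChartTwS U₀)(χ A′) ∘L D = QTwS U₀` for every Fréchet derivative `D` of `χ` at `A′` (`‖A′‖ < ε`, `6ε ≤ e·η`, `U₀ ∈ 𝔘_k(ε₀)`, `10⁹L²e ≤ 1`, `10¹²L³ε₀ ≤ 1`); no estimate.
* §2 ★`norm_chartDeriv_sub_id_le` — `‖D − 1‖ ≤ 2C₂ˢbε` (lit ✓`B11Prop3Model.norm_fderiv_Dfix_le` at ✓`Prop7CmapTwSymInputs.inputs_CmapTwS`, uniqueness of the derivative), hence
  ★`chartDeriv_surjective` (`9C₂ˢbε < 1`; ✓`Prop7SymFrameGaugeResponseAt.surjective_of_norm_sub_smul_one_lt`) and ★★`exists_kerQTwS_of_sliceTangent`: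
  **`ker fderiv(logChartTwS U₀)(χA′) = D(ker QTwS U₀)`** (the inclusion used downstream: every twisted-slice tangent `β` is `Dδ₀` with `QTwS U₀ δ₀ = 0`).
* §3 ★★★`exists_slice_of_core` — the ABSTRACT reduction: for continuous linear `T`, `D` with `T ∘L D = QTwS U₀`, `D` onto, ANY bondwise linear velocity maps `M b` and ANY gauge-term
  map `Gd`: (P2-core) «for every `l` with `toL2S l ∈ N_S(U₀)` the pushed `U₀`-gauge direction `M(D(toL2⁻¹ D_{U₀} toL2S l))` is `M(Dσ′) + Gd N′` with `σ′` in the linear slice» ⟹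
  (P2) «every `β ∈ ker T` is `M β = M(Dδ) + Gd N` with `δ` in the linear slice» — by STEP 2 = the Hilbert half ✓`Prop7GaugeSliceDecomposition.exists_slice_add_gaugeDir_pi` and linearity.
* §4 ★★★`hSplitP2_of_core` — §3 AT THE CHART: hypotheses = those of ✓`Prop7FibreELOfCritSplit.hasFDerivAt_chartTwS_of_lt` ((D47): `hb`, `hHop`, `hq`, `hRε`, `2‖A′‖ < ε`) + `Chart47T3twS`
  + `QTwS ∘ H = id` + `HasFDerivAt χ D A′` + (P2-core); conclusion = (P2) for `T := fderiv ℂ (logChartTwS U₀) (χ A′)`.  The consumer instantiates `M b := gSer ℂ (ad ℂ (−χ(A′) b))` and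
  `Gd N b := N(b₋) − U′(b)·N(b₊)·U′(b)⁻¹` (T5-B's letters) or `Complex.I • N b.src − … ` (`hSplitD`'s), definitionally.
* the `𝔰𝔲(2)` twin (`hSplitD`'s real currency: `δ` `𝔰𝔲(2)`-valued, `N` Hermitian-traceless) is the sibling file `…LandauTransversalityReductionSU2` (same namespace).
HONEST SCOPE.  Exact bookkeeping (chain rule, Neumann-size of `Dχ`, finite-dimensional linear algebra) over landed letters; (P2-core) is a HYPOTHESIS here — its supplier is the Neumann
perturbation of [Balaban1985BackgroundPropagators] (3.22) located in the memo (§4 there), resting on a volume-uniform sup-norm bound for the `N_S`-solve (N06(d = 3)-class); the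
𝔰𝔲(2)-reality of T5-B's `β` is the θ-hand's (★w4-20520 g6); nothing of print is asserted; no stub ∕ crux statement is advanced.

References: T. Bałaban, CMP 102 (1985) 277–309 [Balaban1985Variational] ((44)–(49) p.285, (45) p.285, (82)–(83) p.290, Prop. 3 p.289, (123)–(127) pp.296–297); CMP 99 (1985) 389–434
[Balaban1985BackgroundPropagators] ((3.3) p.391, (3.20)–(3.23) p.394, (3.110) p.417, (3.115) p.418); CMP 99 (1985) 75–102 [Balaban1985RegularSpaces] (Sect. D pp.89–95).
-/

set_option autoImplicit false

noncomputable section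

open scoped Matrix.Norms.L2Operator Topology
open Filter Metric

namespace Summit.QuantumFields.YangMills.Theorems.Prop7LandauTransversalityReduction

open Literature.MathematicalPhysics.QuantumFieldTheory.Balaban1983to89
open Literature.MathematicalPhysics.QuantumFieldTheory.Balaban1983to89.T3ContinuumYM3Torus
open Literature.MathematicalPhysics.QuantumFieldTheory.Balaban1983to89.T3PrintedRegularMinimiser (RegPr)
open Literature.MathematicalPhysics.QuantumFieldTheory.Balaban1983to89.T3SectALandauChart (eta eta_pos)
open B11Prop3Model (Dfix norm_fderiv_Dfix_le)
open Summit.QuantumFields.YangMills.Theorems.Prop7SymAvgTwSym (logChartTwS QTwS CmapTwS Chart47T3twS logChartTwS_eq_QTwS_of_chart47twS)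
open Summit.QuantumFields.YangMills.Theorems.Prop7CmapTwSymInputs (inputs_CmapTwS analyticOnNhd_logChartTwS)
open Summit.QuantumFields.YangMills.Theorems.Prop7SectET3HilbertLetters (W₂ toL2 toL2S DL2)
open Summit.QuantumFields.YangMills.Theorems.Prop7SectET3GaugeProjector (NS RSPi DstarPi)
open Summit.QuantumFields.YangMills.Theorems.Prop7SPrint (IsLandauPrintS)
open Summit.QuantumFields.YangMills.Theorems.Prop7GaugeSliceDecomposition (exists_slice_add_gaugeDir_pi)
open Summit.QuantumFields.YangMills.Theorems.Prop7SymFrameGaugeResponseAt (surjective_of_norm_sub_smul_one_lt)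

variable (F : T3Family) {n K : ℕ} (h : n ≤ K)

/-! ## §1 STEP 1 — the chain rule on (48)-twS: `fderiv(logChartTwS U₀)(χ A′) ∘ Dχ(A′) = Q(U₀)` -/

/-- ★ **STEP 1: `D(log U̿^{twS})(χ(A′)) ∘L Dχ(A′) = Q(U₀)`.**  At `U₀ ∈ 𝔘_k(ε₀)` (`10⁹L²e ≤ 1`, `10¹²L³ε₀ ≤ 1`), with `Chart47T3twS C₂ ε U₀ H`, `Q(U₀)∘H = id` and `6ε ≤ e·η`: the (48)-twS
identity `log U̿^{twS}(χ(A″)) = Q(U₀)A″` holds on the OPEN ball `‖A″‖ < ε` (✓`logChartTwS_eq_QTwS_of_chart47twS`), `log U̿^{twS}` is analytic at `χ(A′)` (`‖χ(A′)‖ < 2ε < e·η`,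
✓`analyticOnNhd_logChartTwS`), so for every Fréchet derivative `D` of `χ` at `A′` (`‖A′‖ < ε`) the chain rule and uniqueness of the derivative give the operator identity.  No estimate.
[cite: Balaban1985Variational, (44)–(49) p.285, Prop. 3 p.289; Balaban1985BackgroundPropagators, (3.13)–(3.14) p.393] -/
theorem fderiv_logChartTwS_comp_chartDeriv_eq_QTwS {ε₀ e C₂ ε : ℝ} (hε₀ : 0 < ε₀) (he : 0 < e) (hWe : 10 ^ 9 * (F.L : ℝ) ^ 2 * e ≤ 1) (hWε : 10 ^ 12 * (F.L : ℝ) ^ 3 * ε₀ ≤ 1)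
    (U₀ : GaugeField (F.P K) 0 (Matrix.specialUnitaryGroup (Fin 2) ℂ)) (hreg : RegPr F n K ε₀ U₀)
    {H : (PBond (F.P n) 0 → Matrix (Fin 2) (Fin 2) ℂ) →ₗ[ℂ] (PBond (F.P K) 0 → Matrix (Fin 2) (Fin 2) ℂ)}
    (h47 : Chart47T3twS F n K h C₂ ε U₀ H) (hQH : ∀ X, QTwS F n K h U₀ (H X) = X) (hRε : 6 * ε ≤ e * eta F n K)
    {A' : PBond (F.P K) 0 → Matrix (Fin 2) (Fin 2) ℂ} (hA' : ‖A'‖ < ε)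
    {D : (PBond (F.P K) 0 → Matrix (Fin 2) (Fin 2) ℂ) →L[ℂ] (PBond (F.P K) 0 → Matrix (Fin 2) (Fin 2) ℂ)}
    (hD : HasFDerivAt (fun A : PBond (F.P K) 0 → Matrix (Fin 2) (Fin 2) ℂ => A - H (Dfix (CmapTwS F n K h U₀) H C₂ A)) D A') :
    (fderiv ℂ (logChartTwS F n K h U₀) (A' - H (Dfix (CmapTwS F n K h U₀) H C₂ A'))).comp D = QTwS F n K h U₀ := by
  have hεpos : 0 < ε := lt_of_le_of_lt (norm_nonneg A') hA'
  -- `χ(A′)` lies in the analyticity ball of the twisted log-chart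
  have h2ε : ‖A' - H (Dfix (CmapTwS F n K h U₀) H C₂ A')‖ < 2 * ε := h47.2.2.1 A' hA'
  have hball : A' - H (Dfix (CmapTwS F n K h U₀) H C₂ A') ∈ ball (0 : PBond (F.P K) 0 → Matrix (Fin 2) (Fin 2) ℂ) (e * eta F n K) := by
    rw [mem_ball_zero_iff]; linarith
  have hlog : HasFDerivAt (logChartTwS F n K h U₀) (fderiv ℂ (logChartTwS F n K h U₀) (A' - H (Dfix (CmapTwS F n K h U₀) H C₂ A')))
      (A' - H (Dfix (CmapTwS F n K h U₀) H C₂ A')) :=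
    ((analyticOnNhd_logChartTwS F h hε₀ he hWe hWε U₀ hreg) _ hball).differentiableAt.hasFDerivAt
  have hcomp : HasFDerivAt ((logChartTwS F n K h U₀) ∘ fun A : PBond (F.P K) 0 → Matrix (Fin 2) (Fin 2) ℂ => A - H (Dfix (CmapTwS F n K h U₀) H C₂ A))
      ((fderiv ℂ (logChartTwS F n K h U₀) (A' - H (Dfix (CmapTwS F n K h U₀) H C₂ A'))).comp D) A' := hlog.comp A' hD
  -- (48)-twS holds on a neighbourhood of `A′`
  have hev : (fun A : PBond (F.P K) 0 → Matrix (Fin 2) (Fin 2) ℂ => QTwS F n K h U₀ A)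
      =ᶠ[𝓝 A'] ((logChartTwS F n K h U₀) ∘ fun A : PBond (F.P K) 0 → Matrix (Fin 2) (Fin 2) ℂ => A - H (Dfix (CmapTwS F n K h U₀) H C₂ A)) := by
    have hopen : ∀ᶠ A in 𝓝 A', ‖A‖ < ε := (isOpen_lt continuous_norm continuous_const).mem_nhds hA'
    filter_upwards [hopen] with A hA
    rw [Function.comp_apply]
    exact (logChartTwS_eq_QTwS_of_chart47twS h47 hQH A hA).symm
  have hQ : HasFDerivAt (fun A : PBond (F.P K) 0 → Matrix (Fin 2) (Fin 2) ℂ => QTwS F n K h U₀ A)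
      ((fderiv ℂ (logChartTwS F n K h U₀) (A' - H (Dfix (CmapTwS F n K h U₀) H C₂ A'))).comp D) A' := hcomp.congr_of_eventuallyEq hev
  exact hQ.unique (QTwS F n K h U₀).hasFDerivAt

/-! ## §2 `Dχ(A′)` is within `2C₂ˢbε < 1` of the identity, hence onto; the twisted-slice tangents are chart velocities of `ker Q(U₀)` -/

/-- ★ **`‖Dχ(A′) − 1‖ ≤ 2C₂ˢbε`** in the window of ✓`Prop7FibreELOfCritSplit.hasFDerivAt_chartTwS_of_lt` ((D47): `C₂ˢ = 40·2·3(2e + 2700Lε₀)∕(eη)²`, `‖HY‖ ≤ b‖Y‖`, `9C₂ˢbε < 1`,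
`6ε ≤ e·η`, `2‖A′‖ < ε`): `Dχ(A′) = 1 − H ∘ D(Dfix)(A′)` by uniqueness of the derivative, and `‖D(Dfix)(A′)‖ ≤ 4C₂ˢ(ε∕2)` by lit ✓`B11Prop3Model.norm_fderiv_Dfix_le` ((70)–(73)) at the
`Inputs` ✓`inputs_CmapTwS`. [cite: Balaban1985Variational, (63)–(73) pp.287–289, Prop. 3 p.289] -/
theorem norm_chartDeriv_sub_id_le [Fact (0 < (F.L : ℝ))] {ε₀ e b ε : ℝ} (hε₀ : 0 < ε₀) (he : 0 < e) (hWe : 10 ^ 9 * (F.L : ℝ) ^ 2 * e ≤ 1) (hWε : 10 ^ 12 * (F.L : ℝ) ^ 3 * ε₀ ≤ 1)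
    (U₀ : GaugeField (F.P K) 0 (Matrix.specialUnitaryGroup (Fin 2) ℂ)) (hreg : RegPr F n K ε₀ U₀)
    {H : (PBond (F.P n) 0 → Matrix (Fin 2) (Fin 2) ℂ) →ₗ[ℂ] (PBond (F.P K) 0 → Matrix (Fin 2) (Fin 2) ℂ)} (hb : 0 ≤ b) (hHop : ∀ Y, ‖H Y‖ ≤ b * ‖Y‖)
    (hq : 9 * (40 * (2 * (3 * (2 * e + 2700 * (F.L : ℝ) * ε₀))) / (e * eta F n K) ^ 2) * b * ε < 1) (hRε : 6 * ε ≤ e * eta F n K)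
    {A' : PBond (F.P K) 0 → Matrix (Fin 2) (Fin 2) ℂ} (hA' : 2 * ‖A'‖ < ε)
    {D : (PBond (F.P K) 0 → Matrix (Fin 2) (Fin 2) ℂ) →L[ℂ] (PBond (F.P K) 0 → Matrix (Fin 2) (Fin 2) ℂ)}
    (hD : HasFDerivAt (fun A : PBond (F.P K) 0 → Matrix (Fin 2) (Fin 2) ℂ =>
      A - H (Dfix (CmapTwS F n K h U₀) H (40 * (2 * (3 * (2 * e + 2700 * (F.L : ℝ) * ε₀))) / (e * eta F n K) ^ 2) A)) D A') :
    ‖D - 1‖ ≤ 2 * (40 * (2 * (3 * (2 * e + 2700 * (F.L : ℝ) * ε₀))) / (e * eta F n K) ^ 2) * b * ε := by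
  haveI : CompleteSpace (PBond (F.P n) 0 → Matrix (Fin 2) (Fin 2) ℂ) := FiniteDimensional.complete ℂ _
  haveI : CompleteSpace (PBond (F.P K) 0 → Matrix (Fin 2) (Fin 2) ℂ) := FiniteDimensional.complete ℂ _
  set C₂ : ℝ := 40 * (2 * (3 * (2 * e + 2700 * (F.L : ℝ) * ε₀))) / (e * eta F n K) ^ 2 with hC₂def
  have hη : 0 < eta F n K := eta_pos F n K
  have hC₂ : 0 ≤ C₂ := by
    have hL : (0 : ℝ) < (F.L : ℝ) := Fact.out
    positivity
  -- `H` as a continuous linear map, with operator norm `≤ b`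
  set Hc : (PBond (F.P n) 0 → Matrix (Fin 2) (Fin 2) ℂ) →L[ℂ] (PBond (F.P K) 0 → Matrix (Fin 2) (Fin 2) ℂ) := LinearMap.toContinuousLinearMap H with hHc
  have hHcH : (Hc : (PBond (F.P n) 0 → Matrix (Fin 2) (Fin 2) ℂ) →ₗ[ℂ] (PBond (F.P K) 0 → Matrix (Fin 2) (Fin 2) ℂ)) = H := LinearMap.coe_toContinuousLinearMap H
  have hHcn : ‖Hc‖ ≤ b := ContinuousLinearMap.opNorm_le_bound Hc hb fun Y => by
    rw [hHc, LinearMap.coe_toContinuousLinearMap']; exact hHop Y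
  have hin : B11Prop3Model.Inputs (CmapTwS F n K h U₀) (Hc : (PBond (F.P n) 0 → Matrix (Fin 2) (Fin 2) ℂ) →ₗ[ℂ] (PBond (F.P K) 0 → Matrix (Fin 2) (Fin 2) ℂ))
      C₂ C₂ b ((e * eta F n K) / 4) := by
    rw [hHcH]; exact inputs_CmapTwS F h hε₀ he hWe hWε U₀ hreg hHop
  have hε₃ : 0 < ε / 2 := by linarith [norm_nonneg A']
  have h18 : 18 * C₂ * b * (ε / 2) ≤ 1 := by
    have : 18 * C₂ * b * (ε / 2) = 9 * C₂ * b * ε := by ring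
    rw [this]; exact hq.le
  have h2 : 2 * (ε / 2) ≤ (e * eta F n K) / 4 := by linarith
  have hA'3 : ‖A'‖ < ε / 2 := by linarith
  obtain ⟨hDf, hDfn⟩ := norm_fderiv_Dfix_le hin hC₂ hC₂ hb hε₃ h18 h2 hA'3
  rw [hHcH] at hDf hDfn
  -- `χ = id − H ∘ Dfix`, so `Dχ(A′) = 1 − Hc ∘ D(Dfix)(A′)` by uniqueness
  have hχ : HasFDerivAt (fun A : PBond (F.P K) 0 → Matrix (Fin 2) (Fin 2) ℂ => A - H (Dfix (CmapTwS F n K h U₀) H C₂ A))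
      ((1 : (PBond (F.P K) 0 → Matrix (Fin 2) (Fin 2) ℂ) →L[ℂ] (PBond (F.P K) 0 → Matrix (Fin 2) (Fin 2) ℂ))
        - Hc.comp (fderiv ℂ (Dfix (CmapTwS F n K h U₀) H C₂) A')) A' := by
    have h1 : HasFDerivAt (fun A : PBond (F.P K) 0 → Matrix (Fin 2) (Fin 2) ℂ => Hc (Dfix (CmapTwS F n K h U₀) H C₂ A))
        (Hc.comp (fderiv ℂ (Dfix (CmapTwS F n K h U₀) H C₂) A')) A' := Hc.hasFDerivAt.comp A' hDf
    have h3 := (hasFDerivAt_id (𝕜 := ℂ) A').sub h1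
    have hfun : (fun A : PBond (F.P K) 0 → Matrix (Fin 2) (Fin 2) ℂ => A - H (Dfix (CmapTwS F n K h U₀) H C₂ A))
        = fun A => id A - Hc (Dfix (CmapTwS F n K h U₀) H C₂ A) := by
      funext A; rw [id, LinearMap.coe_toContinuousLinearMap']
    rw [hfun]
    exact h3
  have hDeq : D = 1 - Hc.comp (fderiv ℂ (Dfix (CmapTwS F n K h U₀) H C₂) A') := hD.unique hχ
  have hnn : 0 ≤ 2 * C₂ * b * ε := mul_nonneg (mul_nonneg (mul_nonneg (by norm_num) hC₂) hb) (by linarith)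
  refine ContinuousLinearMap.opNorm_le_bound _ hnn fun x => ?_
  have hx : (D - 1) x = -(Hc (fderiv ℂ (Dfix (CmapTwS F n K h U₀) H C₂) A' x)) := by
    rw [hDeq, sub_apply, sub_apply, one_apply_eq_self, ContinuousLinearMap.comp_apply,
      sub_sub_cancel_left]
  rw [hx, norm_neg]
  calc ‖Hc (fderiv ℂ (Dfix (CmapTwS F n K h U₀) H C₂) A' x)‖
      ≤ ‖Hc‖ * ‖fderiv ℂ (Dfix (CmapTwS F n K h U₀) H C₂) A' x‖ := Hc.le_opNorm _
    _ ≤ b * (‖fderiv ℂ (Dfix (CmapTwS F n K h U₀) H C₂) A'‖ * ‖x‖) := mul_le_mul hHcn (ContinuousLinearMap.le_opNorm _ _) (norm_nonneg _) hb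
    _ ≤ b * ((4 * C₂ * (ε / 2)) * ‖x‖) := by gcongr
    _ = 2 * C₂ * b * ε * ‖x‖ := by ring

/-- ★ **`Dχ(A′)` IS ONTO** (`‖Dχ(A′) − 1‖ ≤ 2C₂ˢbε < 2∕9 < 1` by `9C₂ˢbε < 1`; ✓`surjective_of_norm_sub_smul_one_lt` at `a := 1`). [cite: Balaban1985Variational, (71) p.288, Prop. 3 p.289] -/
theorem chartDeriv_surjective [Fact (0 < (F.L : ℝ))] {ε₀ e b ε : ℝ} (hε₀ : 0 < ε₀) (he : 0 < e) (hWe : 10 ^ 9 * (F.L : ℝ) ^ 2 * e ≤ 1) (hWε : 10 ^ 12 * (F.L : ℝ) ^ 3 * ε₀ ≤ 1)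
    (U₀ : GaugeField (F.P K) 0 (Matrix.specialUnitaryGroup (Fin 2) ℂ)) (hreg : RegPr F n K ε₀ U₀)
    {H : (PBond (F.P n) 0 → Matrix (Fin 2) (Fin 2) ℂ) →ₗ[ℂ] (PBond (F.P K) 0 → Matrix (Fin 2) (Fin 2) ℂ)} (hb : 0 ≤ b) (hHop : ∀ Y, ‖H Y‖ ≤ b * ‖Y‖)
    (hq : 9 * (40 * (2 * (3 * (2 * e + 2700 * (F.L : ℝ) * ε₀))) / (e * eta F n K) ^ 2) * b * ε < 1) (hRε : 6 * ε ≤ e * eta F n K)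
    {A' : PBond (F.P K) 0 → Matrix (Fin 2) (Fin 2) ℂ} (hA' : 2 * ‖A'‖ < ε)
    {D : (PBond (F.P K) 0 → Matrix (Fin 2) (Fin 2) ℂ) →L[ℂ] (PBond (F.P K) 0 → Matrix (Fin 2) (Fin 2) ℂ)}
    (hD : HasFDerivAt (fun A : PBond (F.P K) 0 → Matrix (Fin 2) (Fin 2) ℂ =>
      A - H (Dfix (CmapTwS F n K h U₀) H (40 * (2 * (3 * (2 * e + 2700 * (F.L : ℝ) * ε₀))) / (e * eta F n K) ^ 2) A)) D A') :
    Function.Surjective D := by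
  haveI : CompleteSpace (PBond (F.P K) 0 → Matrix (Fin 2) (Fin 2) ℂ) := FiniteDimensional.complete ℂ _
  have hle := norm_chartDeriv_sub_id_le F h hε₀ he hWe hWε U₀ hreg hb hHop hq hRε hA' hD
  have hC : 0 ≤ 40 * (2 * (3 * (2 * e + 2700 * (F.L : ℝ) * ε₀))) / (e * eta F n K) ^ 2 := by
    have hL : (0 : ℝ) < (F.L : ℝ) := Fact.out
    have hη : 0 < eta F n K := eta_pos F n K
    positivity
  have hεpos : 0 < ε := by linarith [norm_nonneg A']
  have hlt : ‖D - (1 : ℂ) • (1 : (PBond (F.P K) 0 → Matrix (Fin 2) (Fin 2) ℂ) →L[ℂ] (PBond (F.P K) 0 → Matrix (Fin 2) (Fin 2) ℂ))‖ < ‖(1 : ℂ)‖ := by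
    rw [one_smul, norm_one]
    have : 2 * (40 * (2 * (3 * (2 * e + 2700 * (F.L : ℝ) * ε₀))) / (e * eta F n K) ^ 2) * b * ε < 1 := by nlinarith
    exact hle.trans_lt this
  exact surjective_of_norm_sub_smul_one_lt hlt

/-- ★★ **THE TWISTED-SLICE TANGENTS ARE CHART VELOCITIES OF `ker Q(U₀)`**: in the (D47) window, with `Chart47T3twS` and `Q(U₀)∘H = id`, every `β` with `fderiv(log U̿^{twS})(χA′) β = 0`
is `β = Dδ₀` with `QTwS U₀ δ₀ = 0` (STEP 1 + onto-ness of `Dχ(A′)`) — i.e. `𝒯_{A₁} = Dχ(A′)(ker Q(U₀))` (the converse inclusion is STEP 1 read forwards).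
[cite: Balaban1985Variational, (44)–(49) p.285, (82)–(83) p.290, Prop. 3 p.289] -/
theorem exists_kerQTwS_of_sliceTangent [Fact (0 < (F.L : ℝ))] {ε₀ e b ε : ℝ} (hε₀ : 0 < ε₀) (he : 0 < e) (hWe : 10 ^ 9 * (F.L : ℝ) ^ 2 * e ≤ 1) (hWε : 10 ^ 12 * (F.L : ℝ) ^ 3 * ε₀ ≤ 1)
    (U₀ : GaugeField (F.P K) 0 (Matrix.specialUnitaryGroup (Fin 2) ℂ)) (hreg : RegPr F n K ε₀ U₀)
    {H : (PBond (F.P n) 0 → Matrix (Fin 2) (Fin 2) ℂ) →ₗ[ℂ] (PBond (F.P K) 0 → Matrix (Fin 2) (Fin 2) ℂ)} (hb : 0 ≤ b) (hHop : ∀ Y, ‖H Y‖ ≤ b * ‖Y‖)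
    (hq : 9 * (40 * (2 * (3 * (2 * e + 2700 * (F.L : ℝ) * ε₀))) / (e * eta F n K) ^ 2) * b * ε < 1) (hRε : 6 * ε ≤ e * eta F n K)
    (h47 : Chart47T3twS F n K h (40 * (2 * (3 * (2 * e + 2700 * (F.L : ℝ) * ε₀))) / (e * eta F n K) ^ 2) ε U₀ H) (hQH : ∀ X, QTwS F n K h U₀ (H X) = X)
    {A' : PBond (F.P K) 0 → Matrix (Fin 2) (Fin 2) ℂ} (hA' : 2 * ‖A'‖ < ε)
    {D : (PBond (F.P K) 0 → Matrix (Fin 2) (Fin 2) ℂ) →L[ℂ] (PBond (F.P K) 0 → Matrix (Fin 2) (Fin 2) ℂ)}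
    (hD : HasFDerivAt (fun A : PBond (F.P K) 0 → Matrix (Fin 2) (Fin 2) ℂ =>
      A - H (Dfix (CmapTwS F n K h U₀) H (40 * (2 * (3 * (2 * e + 2700 * (F.L : ℝ) * ε₀))) / (e * eta F n K) ^ 2) A)) D A')
    (β : PBond (F.P K) 0 → Matrix (Fin 2) (Fin 2) ℂ)
    (hβ : fderiv ℂ (logChartTwS F n K h U₀)
      (A' - H (Dfix (CmapTwS F n K h U₀) H (40 * (2 * (3 * (2 * e + 2700 * (F.L : ℝ) * ε₀))) / (e * eta F n K) ^ 2) A')) β = 0) :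
    ∃ δ₀ : PBond (F.P K) 0 → Matrix (Fin 2) (Fin 2) ℂ, QTwS F n K h U₀ δ₀ = 0 ∧ D δ₀ = β := by
  have hA'1 : ‖A'‖ < ε := by linarith [norm_nonneg A']
  have hTD := fderiv_logChartTwS_comp_chartDeriv_eq_QTwS F h hε₀ he hWe hWε U₀ hreg h47 hQH hRε hA'1 hD
  obtain ⟨δ₀, hδ₀⟩ := chartDeriv_surjective F h hε₀ he hWe hWε U₀ hreg hb hHop hq hRε hA' hD β
  refine ⟨δ₀, ?_, hδ₀⟩
  have := DFunLike.congr_fun hTD δ₀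
  rw [ContinuousLinearMap.comp_apply, hδ₀] at this
  rw [← this, hβ]

/-! ## §3 STEP 2 + linearity — the abstract reduction (P2) ⟸ (P2-core) -/

/-- ★★★ **(P2) FROM (P2-core), ABSTRACT FORM.**  Let `T`, `D` be continuous linear with `T ∘L D = Q(U₀)` (STEP 1) and `D` onto (§2); let `M b` be ANY bondwise linear velocity maps and `Gd`
ANY gauge-term map.  If (P2-core) holds — for every gauge parameter `l` in the residual gauge algebra (`toL2S l ∈ N_S(U₀) = ker(Q(U₀)∘D_{U₀})`) the pushed `U₀`-gauge direction
`M(D(toL2⁻¹(D_{U₀}(toL2S l))))` is `M(Dσ′) + Gd N′` with `σ′` in print's linear slice (`Q(U₀)σ′ = 0`, `R_S(U₀)D*_{U₀}σ′ = 0`) — then every `β ∈ ker T` is `Mβ = M(Dδ) + Gd N` with `δ`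
in the linear slice.  Proof: `β = Dδ₀`, `Q(U₀)δ₀ = T(Dδ₀) = 0`; Hilbert half ✓`exists_slice_add_gaugeDir_pi`: `δ₀ = S + toL2⁻¹(D_{U₀}(toL2S l))`, `toL2S l ∈ N_S`, `S` in the slice;
(P2-core) on `l`; `δ := S + σ′` (the slice is a subspace). [cite: Balaban1985BackgroundPropagators, (3.3) p.391, (3.20)–(3.23) p.394, (3.110) p.417, (3.115) p.418; Balaban1985Variational, (45) p.285, (82)–(83) p.290] -/
theorem exists_slice_of_core {c₀ cB : ℝ} [Fact (0 < c₀)] [Fact (0 < cB)] (U₀ : GaugeField (F.P K) 0 (Matrix.specialUnitaryGroup (Fin 2) ℂ))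
    {T : (PBond (F.P K) 0 → Matrix (Fin 2) (Fin 2) ℂ) →L[ℂ] (PBond (F.P n) 0 → Matrix (Fin 2) (Fin 2) ℂ)}
    {D : (PBond (F.P K) 0 → Matrix (Fin 2) (Fin 2) ℂ) →L[ℂ] (PBond (F.P K) 0 → Matrix (Fin 2) (Fin 2) ℂ)}
    (hTD : T.comp D = QTwS F n K h U₀) (hDsurj : Function.Surjective D)
    (M : PBond (F.P K) 0 → (Matrix (Fin 2) (Fin 2) ℂ →L[ℂ] Matrix (Fin 2) (Fin 2) ℂ))
    (Gd : (Site (F.P K) 0 → Matrix (Fin 2) (Fin 2) ℂ) → PBond (F.P K) 0 → Matrix (Fin 2) (Fin 2) ℂ)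
    (hcore : ∀ l : Site (F.P K) 0 → Matrix (Fin 2) (Fin 2) ℂ, toL2S F K c₀ l ∈ NS F n K h c₀ cB U₀ →
      ∃ σ' : PBond (F.P K) 0 → Matrix (Fin 2) (Fin 2) ℂ, QTwS F n K h U₀ σ' = 0 ∧ IsLandauPrintS F n K h c₀ cB U₀ σ' ∧
        ∃ N' : Site (F.P K) 0 → Matrix (Fin 2) (Fin 2) ℂ,
          ∀ b, M b (D ((toL2 F K c₀).symm (DL2 F n K c₀ U₀ (toL2S F K c₀ l))) b) = M b (D σ' b) + Gd N' b)
    (β : PBond (F.P K) 0 → Matrix (Fin 2) (Fin 2) ℂ) (hβ : T β = 0) :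
    ∃ δ : PBond (F.P K) 0 → Matrix (Fin 2) (Fin 2) ℂ, QTwS F n K h U₀ δ = 0 ∧ IsLandauPrintS F n K h c₀ cB U₀ δ ∧
      ∃ N : Site (F.P K) 0 → Matrix (Fin 2) (Fin 2) ℂ, ∀ b, M b (β b) = M b (D δ b) + Gd N b := by
  -- `β = Dδ₀` with `Q(U₀)δ₀ = 0`
  obtain ⟨δ₀, hδ₀⟩ := hDsurj β
  have hQ₀ : QTwS F n K h U₀ δ₀ = 0 := by
    have := DFunLike.congr_fun hTD δ₀
    rw [ContinuousLinearMap.comp_apply, hδ₀] at this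
    rw [← this, hβ]
  -- Hilbert half at `U₀`
  obtain ⟨S, l, hl, hQS, hRS, hdec⟩ := exists_slice_add_gaugeDir_pi (h := h) (c₀ := c₀) (cB := cB) U₀ δ₀ hQ₀
  -- (P2-core) on the residual gauge parameter
  obtain ⟨σ', hQσ', hLσ', N', hN'⟩ := hcore l hl
  refine ⟨S + σ', by rw [map_add, hQS, hQσ', add_zero], ?_, N', fun b => ?_⟩
  · show RSPi F n K h c₀ cB U₀ (DstarPi F n K c₀ U₀ (S + σ')) = 0
    have hL' : RSPi F n K h c₀ cB U₀ (DstarPi F n K c₀ U₀ σ') = 0 := hLσ'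
    rw [map_add, map_add, hRS, hL', add_zero]
  · rw [← hδ₀, hdec, map_add, map_add, Pi.add_apply, Pi.add_apply, map_add, map_add, hN', add_assoc]

/-! ## §4 At the chart: `hSplit`'s (P2)-residue from (P2-core) -/

/-- ★★★ **(P2) «LANDAU TRANSVERSALITY AT THE CHART POINT» FROM (P2-core).**  In the (D47) window of ✓`Prop7FibreELOfCritSplit.hasFDerivAt_chartTwS_of_lt` (`U₀ ∈ 𝔘_k(ε₀)`,
`10⁹L²e ≤ 1`, `10¹²L³ε₀ ≤ 1`, `‖HY‖ ≤ b‖Y‖`, `9C₂ˢbε < 1`, `6ε ≤ e·η`, `2‖A′‖ < ε`), with `Chart47T3twS C₂ˢ ε U₀ H`, `Q(U₀)∘H = id`, and ANY Fréchet derivative `D` of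
`χ = (A ↦ A − H·Dfix(CmapTwS U₀) H C₂ˢ A)` at `A′`: if (P2-core) holds for the bondwise velocity maps `M` and the gauge-term map `Gd` (the consumer's: `M b = gSer ℂ (ad ℂ (−χ(A′) b))`,
`Gd N b = N(b₋) − U′(b)N(b₊)U′(b)⁻¹` at `U′ = e^{χ(A′)}U₀`), then every `β` tangent to the twisted slice at `χ(A′)` (`fderiv ℂ (logChartTwS U₀) (χ A′) β = 0` — T5-B's output) satisfies
`Mβ = M(Dδ) + Gd N` with `Q(U₀)δ = 0`, `IsLandauPrintS c₀ cB U₀ δ` — `hSplit`∕`hSplitD`'s slice currency.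
[cite: Balaban1985Variational, (44)–(49) p.285, (45) p.285, (82)–(83) p.290, Prop. 3 p.289, (123)–(127) pp.296–297; Balaban1985BackgroundPropagators, (3.20)–(3.23) p.394, (3.115) p.418; Balaban1985RegularSpaces, Sect. D pp.89–95] -/
theorem hSplitP2_of_core [Fact (0 < (F.L : ℝ))] {c₀ cB : ℝ} [Fact (0 < c₀)] [Fact (0 < cB)]
    {ε₀ e b ε : ℝ} (hε₀ : 0 < ε₀) (he : 0 < e) (hWe : 10 ^ 9 * (F.L : ℝ) ^ 2 * e ≤ 1) (hWε : 10 ^ 12 * (F.L : ℝ) ^ 3 * ε₀ ≤ 1)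
    (U₀ : GaugeField (F.P K) 0 (Matrix.specialUnitaryGroup (Fin 2) ℂ)) (hreg : RegPr F n K ε₀ U₀)
    {H : (PBond (F.P n) 0 → Matrix (Fin 2) (Fin 2) ℂ) →ₗ[ℂ] (PBond (F.P K) 0 → Matrix (Fin 2) (Fin 2) ℂ)} (hb : 0 ≤ b) (hHop : ∀ Y, ‖H Y‖ ≤ b * ‖Y‖)
    (hq : 9 * (40 * (2 * (3 * (2 * e + 2700 * (F.L : ℝ) * ε₀))) / (e * eta F n K) ^ 2) * b * ε < 1) (hRε : 6 * ε ≤ e * eta F n K)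
    (h47 : Chart47T3twS F n K h (40 * (2 * (3 * (2 * e + 2700 * (F.L : ℝ) * ε₀))) / (e * eta F n K) ^ 2) ε U₀ H) (hQH : ∀ X, QTwS F n K h U₀ (H X) = X)
    {A' : PBond (F.P K) 0 → Matrix (Fin 2) (Fin 2) ℂ} (hA' : 2 * ‖A'‖ < ε)
    {D : (PBond (F.P K) 0 → Matrix (Fin 2) (Fin 2) ℂ) →L[ℂ] (PBond (F.P K) 0 → Matrix (Fin 2) (Fin 2) ℂ)}
    (hD : HasFDerivAt (fun A : PBond (F.P K) 0 → Matrix (Fin 2) (Fin 2) ℂ =>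
      A - H (Dfix (CmapTwS F n K h U₀) H (40 * (2 * (3 * (2 * e + 2700 * (F.L : ℝ) * ε₀))) / (e * eta F n K) ^ 2) A)) D A')
    (M : PBond (F.P K) 0 → (Matrix (Fin 2) (Fin 2) ℂ →L[ℂ] Matrix (Fin 2) (Fin 2) ℂ))
    (Gd : (Site (F.P K) 0 → Matrix (Fin 2) (Fin 2) ℂ) → PBond (F.P K) 0 → Matrix (Fin 2) (Fin 2) ℂ)
    (hcore : ∀ l : Site (F.P K) 0 → Matrix (Fin 2) (Fin 2) ℂ, toL2S F K c₀ l ∈ NS F n K h c₀ cB U₀ →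
      ∃ σ' : PBond (F.P K) 0 → Matrix (Fin 2) (Fin 2) ℂ, QTwS F n K h U₀ σ' = 0 ∧ IsLandauPrintS F n K h c₀ cB U₀ σ' ∧
        ∃ N' : Site (F.P K) 0 → Matrix (Fin 2) (Fin 2) ℂ,
          ∀ b, M b (D ((toL2 F K c₀).symm (DL2 F n K c₀ U₀ (toL2S F K c₀ l))) b) = M b (D σ' b) + Gd N' b)
    (β : PBond (F.P K) 0 → Matrix (Fin 2) (Fin 2) ℂ)
    (hβ : fderiv ℂ (logChartTwS F n K h U₀)
      (A' - H (Dfix (CmapTwS F n K h U₀) H (40 * (2 * (3 * (2 * e + 2700 * (F.L : ℝ) * ε₀))) / (e * eta F n K) ^ 2) A')) β = 0) :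
    ∃ δ : PBond (F.P K) 0 → Matrix (Fin 2) (Fin 2) ℂ, QTwS F n K h U₀ δ = 0 ∧ IsLandauPrintS F n K h c₀ cB U₀ δ ∧
      ∃ N : Site (F.P K) 0 → Matrix (Fin 2) (Fin 2) ℂ, ∀ b, M b (β b) = M b (D δ b) + Gd N b := by
  have hA'1 : ‖A'‖ < ε := by linarith [norm_nonneg A']
  exact exists_slice_of_core F h U₀ (fderiv_logChartTwS_comp_chartDeriv_eq_QTwS F h hε₀ he hWe hWε U₀ hreg h47 hQH hRε hA'1 hD)
    (chartDeriv_surjective F h hε₀ he hWe hWε U₀ hreg hb hHop hq hRε hA' hD) M Gd hcore β hβ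

end Summit.QuantumFields.YangMills.Theorems.Prop7LandauTransversalityReduction

end
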